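import Mathlib.NumberTheory.LSeries.DirichletContinuation
import HarnessLib

/-!
# Small `L(1,χ)` forces an exceptional zero: the dichotomy of Montgomery–Vaughan, Theorem 11.4 ((11.7), (11.10))

H. L. Montgomery, R. C. Vaughan, *Multiplicative Number Theory I: Classical Theory*, Cambridge Studies in Advanced
Mathematics 97 (2007) [MontgomeryVaughan2007], §11.1 Theorem 11.4, p. 360 of the print (pp. 277–278 of the held
text).  A NAMED FACT (theorem-in-print), typed statement-first; nothing here is proved.

The printed theorem: for a non-principal `χ (mod q)`, `c` the constant of the zero-free region (Theorem 11.3) and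
`σ ≥ 1 − c/(2 log qτ)` (`τ = |t| + 4`): if `L(s,χ)` has no exceptional zero, or has one `β₁` with `|s − β₁| ≥ 1/log q`,
then `1/L(s,χ) ≪ log qτ` (11.7); alternatively, if `β₁` is an exceptional zero and `|s − β₁| ≤ 1/log q`, then
`|s − β₁| ≪ |L(s,χ)| ≪ |s − β₁|(log q)²` (11.10).  At `s = 1` this is the DICHOTOMY typed below: either
`L(1,χ) ≥ c₁/log(4q)`, or `L(s,χ)` has a real zero `β < 1` with `1 − β ≤ C·L(1,χ)` (absolute `c₁, C > 0`).  Why it is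
wanted in this tree: it turns a hypothesis «`L(1,χ)` is small» (e.g. Zhang's Assumption (A) `L(1,χ) < 𝓛⁻²⁰²²`,
`Literature.NumberTheory.LFunctions.Zhang2022.Skeleton.AssumptionA`) into «an exceptional zero of quality
`η ≥ c·𝓛²⁰²¹` exists» (`Literature.Barriers.Parity.IsSiegelZero`), the hypothesis under which the Tao–Teräväinen
Siegel-model facts of the tree are stated (used by the Landau–Siegel programme's §D card `siegel-model-moduli`).

## References
* H. L. Montgomery, R. C. Vaughan, *Multiplicative Number Theory I* (CUP 2007), §11.1 Theorem 11.4 (11.7), (11.10);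
  §11.2 Corollary 11.12. [cite: MontgomeryVaughan2007, §11.1 Theorem 11.4]
-/

noncomputable section

namespace Literature.NumberTheory.LFunctions

/-- **Montgomery–Vaughan 2007, Theorem 11.4 at `s = 1` — the exceptional-zero dichotomy (NAMED FACT, theorem in
print; nothing asserted here):** there are absolute constants `c₁, C > 0` such that for every modulus `q ≥ 2` and every
non-principal Dirichlet character `χ (mod q)`, EITHER `L(1,χ) ≥ c₁/log(4q)` ((11.7) at `s = 1`, `τ = 4`: no exceptional
zero, or the exceptional zero is at distance `≥ 1/log q` from `1`), OR `L(s,χ)` has a real zero `β < 1` with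
`1 − β ≤ C·|L(1,χ)|` ((11.10) at `s = 1`: `|1 − β₁| ≪ |L(1,χ)|`).  (For complex `χ` the first alternative always
holds; the exceptional zero, when it exists, is a real simple zero of `L(s,χ)` for a quadratic `χ`, §11.1.)
[cite: MontgomeryVaughan2007, §11.1 Theorem 11.4 (11.7) (11.10)] -/
def montgomeryVaughan2007_theorem114_dichotomy : Prop :=
  ∃ c₁ C : ℝ, 0 < c₁ ∧ 0 < C ∧
    ∀ (q : ℕ) [NeZero q] (χ : DirichletCharacter ℂ q), 2 ≤ q → χ ≠ 1 →
      c₁ / Real.log (4 * q) ≤ ‖χ.LFunction 1‖ ∨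
        ∃ β : ℝ, β < 1 ∧ 1 - β ≤ C * ‖χ.LFunction 1‖ ∧ χ.LFunction (β : ℂ) = 0

end Literature.NumberTheory.LFunctions

end
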